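import Literature.Analysis.InverseSpectral.StieltjesDataUnique
import Literature.Analysis.InverseSpectral.StieltjesRepresentation
import HarnessLib

/-!
# Approximation of Stieltjes functions by rational ones

Every `q ∈ N_S` (`HasStieltjesRepresentation q b σ`) is the pointwise limit on `ℂ ∖ [0, ∞)` of
functions `q_n(z) = b + ∫ dσ_n(λ)/(λ - z)` whose measures `σ_n` are finite and carried by the finite
sets `{k/n : k < n²}` (`σ_n` = push-forward of `σ|[0,n)` under `λ ↦ ⌊nλ⌋/n`): the data
`(b, σ_n)` are again Stieltjes data and `q_n(z) → q(z)` (`tendsto_discretised_stieltjes`). This is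
the density step in the approximation proof of the existence part of Kreĭn's inverse spectral
theorem (Kac–Kreĭn 1974 §11; Kotani–Watanabe 1982 §2).

## References

KacKrein1974 (§11, Supplement I), KotaniWatanabe1982 (§2).
-/

open MeasureTheory Filter Set Topology
open scoped ENNReal

noncomputable section

namespace Literature.Analysis.InverseSpectral

/-! ### The discretisation map `λ ↦ ⌊nλ⌋/n` -/

/-- The discretisation map `r_n(λ) = ⌊nλ⌋₊/n`. [folklore] -/
def discretise (n : ℕ) (t : ℝ) : ℝ := (⌊t * n⌋₊ : ℝ) / n

/-- `r_n` is measurable. [folklore] -/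
lemma measurable_discretise (n : ℕ) : Measurable (discretise n) :=
  (measurable_from_nat.comp (Nat.measurable_floor.comp (measurable_id.mul_const _))).div_const _

/-- `r_n ≥ 0`. [folklore] -/
lemma discretise_nonneg (n : ℕ) (t : ℝ) : 0 ≤ discretise n t := by
  unfold discretise; positivity

/-- `r_n(t) ≤ t` for `t ≥ 0`. [folklore] -/
lemma discretise_le {n : ℕ} (hn : 0 < n) {t : ℝ} (ht : 0 ≤ t) : discretise n t ≤ t := by
  unfold discretise
  rw [div_le_iff₀ (by exact_mod_cast hn)]
  exact Nat.floor_le (by positivity)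

/-- `t - r_n(t) < 1/n`. [folklore] -/
lemma sub_discretise_lt {n : ℕ} (hn : 0 < n) (t : ℝ) : t - discretise n t < 1 / n := by
  unfold discretise
  have h := Nat.lt_floor_add_one (t * n)
  have hn' : (0 : ℝ) < n := by exact_mod_cast hn
  rw [sub_lt_iff_lt_add, ← add_div, lt_div_iff₀ hn']
  linarith

/-- `|t - r_n(t)| ≤ 1/n` for `t ≥ 0`. [folklore] -/
lemma abs_sub_discretise_le {n : ℕ} (hn : 0 < n) {t : ℝ} (ht : 0 ≤ t) :
    |t - discretise n t| ≤ 1 / n := by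
  rw [abs_of_nonneg (sub_nonneg.2 (discretise_le hn ht))]
  exact (sub_discretise_lt hn t).le

/-- The values of `r_n` on `[0, n)` lie in the finite set `{k/n : k < n²}`. [folklore] -/
lemma discretise_mem {n : ℕ} (hn : 0 < n) {t : ℝ} (ht : t ∈ Ico (0 : ℝ) n) :
    discretise n t ∈ (Finset.range (n * n)).image (fun k : ℕ => (k : ℝ) / n) := by
  rw [Finset.mem_image]
  refine ⟨⌊t * n⌋₊, Finset.mem_range.2 ?_, rfl⟩
  have hn' : (0 : ℝ) < n := by exact_mod_cast hn
  have h1 : t * n < n * n := by nlinarith [ht.2, ht.1]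
  have h2 : (⌊t * n⌋₊ : ℝ) ≤ t * n := Nat.floor_le (by nlinarith [ht.1])
  exact_mod_cast (show (⌊t * n⌋₊ : ℝ) < n * n from h2.trans_lt h1)

/-! ### The discretised measures -/

section Discretised

variable {q : ℂ → ℂ} {b : ℝ} {σ : Measure ℝ}

/-- `σ`-a.e. `t ≥ 0` for Stieltjes data (local copy). [folklore] -/
private lemma ae_nonneg_of_hasStieltjesRepresentation' (h : HasStieltjesRepresentation q b σ) :
    ∀ᵐ t ∂σ, (0 : ℝ) ≤ t := by
  rw [ae_iff]
  have hset : {a : ℝ | ¬0 ≤ a} = Iio 0 := by ext a; simp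
  rw [hset]
  exact h.2.1

/-- The discretised measure `σ_n = (σ|[0,n)) ∘ r_n⁻¹`. [folklore] -/
def discretisedMeasure (σ : Measure ℝ) (n : ℕ) : Measure ℝ :=
  (σ.restrict (Ico (0 : ℝ) n)).map (discretise n)

/-- `σ_n` is a finite measure. [folklore] -/
lemma isFiniteMeasure_discretisedMeasure (h : HasStieltjesRepresentation q b σ) (n : ℕ) :
    IsFiniteMeasure (discretisedMeasure σ n) := by
  haveI : IsFiniteMeasure (σ.restrict (Ico (0 : ℝ) n)) := by
    refine ⟨?_⟩
    rw [Measure.restrict_apply_univ]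
    have hw := integrable_inv_one_add_of_hasStieltjesRepresentation h
    have hsub : Ico (0 : ℝ) n ⊆ {t : ℝ | ((1 : ℝ) + n)⁻¹ ≤ (1 + t)⁻¹} := fun t ht => by
      have h1 : (0 : ℝ) ≤ t := ht.1
      have h2 : t < (n : ℝ) := ht.2
      show ((1 : ℝ) + n)⁻¹ ≤ (1 + t)⁻¹
      exact inv_anti₀ (by linarith : (0 : ℝ) < 1 + t) (by linarith : (1 : ℝ) + t ≤ 1 + n)
    exact (measure_mono hsub).trans_lt (hw.measure_ge_lt_top (by positivity))
  exact Measure.isFiniteMeasure_map _ _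

/-- `σ_n` is carried by the finite set `{k/n : k < n²}`. [folklore] -/
lemma discretisedMeasure_compl_eq_zero {n : ℕ} (hn : 0 < n) (σ : Measure ℝ) :
    discretisedMeasure σ n (↑((Finset.range (n * n)).image (fun k : ℕ => (k : ℝ) / n)))ᶜ = 0 := by
  unfold discretisedMeasure
  rw [Measure.map_apply (measurable_discretise n) (Finset.measurableSet _).compl,
    Measure.restrict_apply ((measurable_discretise n) (Finset.measurableSet _).compl)]
  have : discretise n ⁻¹' (↑((Finset.range (n * n)).image (fun k : ℕ => (k : ℝ) / n)))ᶜ ∩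
      Ico (0 : ℝ) n = ∅ := by
    ext t
    simp only [mem_inter_iff, mem_preimage, mem_compl_iff, Finset.mem_coe, mem_empty_iff_false,
      iff_false, not_and]
    intro h ht
    exact h (discretise_mem hn ht)
  rw [this, measure_empty]

/-- `σ_n` does not charge `(-∞, 0)`. [folklore] -/
lemma discretisedMeasure_Iio_zero (n : ℕ) (σ : Measure ℝ) : discretisedMeasure σ n (Iio 0) = 0 := by
  unfold discretisedMeasure
  rw [Measure.map_apply (measurable_discretise n) measurableSet_Iio]
  have : discretise n ⁻¹' Iio 0 = ∅ := by
    ext t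
    simp only [mem_preimage, mem_Iio, mem_empty_iff_false, iff_false, not_lt]
    exact discretise_nonneg n t
  rw [this, Measure.restrict_apply MeasurableSet.empty, empty_inter, measure_empty]

/-- **The discretised data are Stieltjes data** for `q_n(z) = b + ∫ dσ_n/(λ - z)`.
[cite: KacKrein1974, §11] -/
theorem hasStieltjesRepresentation_discretised (h : HasStieltjesRepresentation q b σ) (n : ℕ) :
    HasStieltjesRepresentation
      (fun z => (b : ℂ) + ∫ t : ℝ, ((t : ℂ) - z)⁻¹ ∂(discretisedMeasure σ n))
      b (discretisedMeasure σ n) := by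
  haveI := isFiniteMeasure_discretisedMeasure h n
  refine ⟨h.1, discretisedMeasure_Iio_zero n σ, ?_, fun z _ => rfl⟩
  have hae : ∀ᵐ t ∂(discretisedMeasure σ n), (0 : ℝ) ≤ t := by
    rw [ae_iff]
    have hset : {a : ℝ | ¬0 ≤ a} = Iio 0 := by ext a; simp
    rw [hset]
    exact discretisedMeasure_Iio_zero n σ
  refine lt_of_le_of_lt (lintegral_mono_ae ?_ : _ ≤ ∫⁻ _ : ℝ, 1 ∂(discretisedMeasure σ n)) ?_
  · filter_upwards [hae] with t ht
    rw [← ENNReal.ofReal_one]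
    exact ENNReal.ofReal_le_ofReal (inv_le_one_of_one_le₀ (by linarith))
  · rw [lintegral_one]; exact measure_lt_top _ _

/-- Integrals against `σ_n` are integrals of the discretised integrand against `σ|[0,n)`.
[folklore] -/
lemma integral_discretisedMeasure (σ : Measure ℝ) (n : ℕ) {f : ℝ → ℂ} (hf : Measurable f) :
    ∫ t, f t ∂(discretisedMeasure σ n) = ∫ t in Ico (0 : ℝ) n, f (discretise n t) ∂σ := by
  unfold discretisedMeasure
  rw [integral_map (measurable_discretise n).aemeasurable hf.aestronglyMeasurable]

/-- **Convergence of the discretised Stieltjes functions**: `b + ∫ dσ_n/(λ - z) → q(z)` for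
`z ∉ [0, ∞)`. [cite: KacKrein1974, §11] -/
theorem tendsto_discretised_stieltjes (h : HasStieltjesRepresentation q b σ) {z : ℂ}
    (hz : z ∈ offNonnegAxis) :
    Tendsto (fun n : ℕ => (b : ℂ) + ∫ t : ℝ, ((t : ℂ) - z)⁻¹ ∂(discretisedMeasure σ n)) atTop
      (𝓝 (q z)) := by
  have hae := ae_nonneg_of_hasStieltjesRepresentation' h
  have hw := integrable_inv_one_add_of_hasStieltjesRepresentation h
  obtain ⟨D, hD0, hD⟩ := exists_norm_inv_sub_le hz
  set f : ℝ → ℂ := fun t => ((t : ℂ) - z)⁻¹ with hf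
  have hfm : Measurable f := (Complex.measurable_ofReal.sub_const z).inv
  have hfi : Integrable f σ := by
    refine Integrable.mono' (hw.const_mul D) hfm.aestronglyMeasurable ?_
    filter_upwards [hae] with t ht
    exact hD t ht
  rw [h.2.2.2 z hz]
  refine tendsto_const_nhds.add ?_
  -- `∫ f dσ_n - ∫ f dσ = A_n - B_n`
  have hsplit : ∀ n : ℕ, ∫ t, f t ∂(discretisedMeasure σ n) - ∫ t, f t ∂σ =
      (∫ t in Ico (0 : ℝ) n, (f (discretise n t) - f t) ∂σ) - ∫ t in (Ico (0 : ℝ) n)ᶜ, f t ∂σ := by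
    intro n
    rw [integral_discretisedMeasure σ n hfm, ← integral_add_compl measurableSet_Ico hfi,
      integral_sub _ hfi.integrableOn]
    · ring
    · -- integrability of `f ∘ r_n` on `[0, n)`: bounded by `D`, finite measure
      haveI := isFiniteMeasure_discretisedMeasure h n
      have hfin : σ (Ico (0 : ℝ) n) < ⊤ := by
        have := measure_lt_top (discretisedMeasure σ n) univ
        unfold discretisedMeasure at this
        rwa [Measure.map_apply (measurable_discretise n) MeasurableSet.univ, preimage_univ,
          Measure.restrict_apply_univ] at this
      haveI : IsFiniteMeasure (σ.restrict (Ico (0 : ℝ) n)) :=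
        ⟨by rwa [Measure.restrict_apply_univ]⟩
      refine Integrable.mono' (integrable_const D)
        (hfm.comp (measurable_discretise n)).aestronglyMeasurable (ae_of_all _ fun t => ?_)
      calc ‖f (discretise n t)‖ ≤ D * (1 + discretise n t)⁻¹ := hD _ (discretise_nonneg n t)
        _ ≤ D * 1 := by
            refine mul_le_mul_of_nonneg_left ?_ hD0
            exact inv_le_one_of_one_le₀ (by linarith [discretise_nonneg n t])
        _ = D := mul_one D
  have hne : ∀ u : ℝ, 0 ≤ u → (u : ℂ) - z ≠ 0 := fun u hu h0 => by
    have hzu : z = (u : ℂ) := (sub_eq_zero.1 h0).symm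
    rcases hz with him | hre
    · exact him (by rw [hzu, Complex.ofReal_im])
    · rw [hzu, Complex.ofReal_re] at hre
      linarith
  have hkey : Tendsto (fun n : ℕ => ∫ t, f t ∂(discretisedMeasure σ n) - ∫ t, f t ∂σ) atTop
      (𝓝 0) := by
    simp_rw [hsplit]
    rw [← sub_zero (0 : ℂ)]
    refine Tendsto.sub ?_ ?_
    · -- `A_n → 0`
      have hbound : ∀ n : ℕ, 0 < n → ‖∫ t in Ico (0 : ℝ) n, (f (discretise n t) - f t) ∂σ‖ ≤
          D * D * (∫ t, (1 + t)⁻¹ ∂σ) / n := by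
        intro n hn
        have hn' : (0 : ℝ) < n := by exact_mod_cast hn
        calc ‖∫ t in Ico (0 : ℝ) n, (f (discretise n t) - f t) ∂σ‖
            ≤ ∫ t in Ico (0 : ℝ) n, D * D / n * (1 + t)⁻¹ ∂σ := by
              refine norm_integral_le_of_norm_le ((hw.const_mul _).integrableOn) ?_
              rw [ae_restrict_iff' measurableSet_Ico]
              refine ae_of_all _ (fun t ht => ?_)
              have ht0 : 0 ≤ t := ht.1
              have hr0 := discretise_nonneg n t
              have h1 : f (discretise n t) - f t =
                  (((t - discretise n t : ℝ) : ℂ)) * ((((discretise n t : ℝ) : ℂ) - z)⁻¹ *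
                    (((t : ℂ) - z)⁻¹)) := by
                simp only [hf]
                rw [inv_sub_inv (hne _ hr0) (hne _ ht0)]
                push_cast
                field_simp [hne _ hr0, hne _ ht0]
                ring
              rw [h1, norm_mul, norm_mul, Complex.norm_real, Real.norm_eq_abs]
              calc |t - discretise n t| * (‖(((discretise n t : ℝ) : ℂ) - z)⁻¹‖ * ‖((t : ℂ) - z)⁻¹‖)
                  ≤ (1 / n) * (D * (D * (1 + t)⁻¹)) := by
                    refine mul_le_mul (abs_sub_discretise_le hn ht0) ?_ (by positivity)
                      (by positivity)
                    refine mul_le_mul ?_ (hD t ht0) (norm_nonneg _) hD0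
                    calc ‖(((discretise n t : ℝ) : ℂ) - z)⁻¹‖ ≤ D * (1 + discretise n t)⁻¹ :=
                          hD _ hr0
                      _ ≤ D * 1 := mul_le_mul_of_nonneg_left
                          (inv_le_one_of_one_le₀ (by linarith)) hD0
                      _ = D := mul_one D
                _ = D * D / n * (1 + t)⁻¹ := by ring
          _ ≤ ∫ t, D * D / n * (1 + t)⁻¹ ∂σ := by
              refine setIntegral_le_integral (hw.const_mul _) ?_
              filter_upwards [hae] with t ht
              positivity
          _ = D * D * (∫ t, (1 + t)⁻¹ ∂σ) / n := by rw [integral_const_mul]; ring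
      refine squeeze_zero_norm' ?_
        (tendsto_const_div_atTop_nhds_zero_nat (D * D * ∫ t, (1 + t)⁻¹ ∂σ))
      filter_upwards [eventually_gt_atTop 0] with n hn
      exact hbound n hn
    · -- `B_n → 0`
      have hanti : Antitone (fun n : ℕ => (Ico (0 : ℝ) n)ᶜ) := by
        intro n m hnm
        refine compl_subset_compl.2 (Ico_subset_Ico_right ?_)
        exact_mod_cast hnm
      have hlim := tendsto_setIntegral_of_antitone (μ := σ) (f := f)
        (fun n : ℕ => (measurableSet_Ico (a := (0 : ℝ)) (b := (n : ℝ))).compl) hanti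
        ⟨0, hfi.integrableOn⟩
      have hI : (⋂ n : ℕ, (Ico (0 : ℝ) n)ᶜ) = Iio 0 := by
        ext t
        simp only [mem_iInter, mem_compl_iff, mem_Ico, not_and, not_lt, mem_Iio]
        constructor
        · intro ht
          by_contra h0
          obtain ⟨n, hn⟩ := exists_nat_gt t
          exact absurd (ht n (not_lt.1 h0)) (not_le.2 hn)
        · intro ht n h0
          linarith
      rw [hI, Measure.restrict_eq_zero.2 h.2.1, integral_zero_measure] at hlim
      exact hlim
  have := hkey.add_const (∫ t, f t ∂σ)
  simpa using this

/-- **`σ_n` is a finite combination of Dirac masses** at the points `k/n`, `k < n²`.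
[folklore] -/
theorem discretisedMeasure_eq_sum_dirac {n : ℕ} (hn : 0 < n) (σ : Measure ℝ) :
    discretisedMeasure σ n =
      ∑ a ∈ (Finset.range (n * n)).image (fun k : ℕ => (k : ℝ) / n),
        discretisedMeasure σ n {a} • Measure.dirac a := by
  rw [← Measure.ae_mem_finset_iff, ae_iff]
  have h := discretisedMeasure_compl_eq_zero hn σ
  have hset : {a : ℝ | ¬a ∈ (Finset.range (n * n)).image (fun k : ℕ => (k : ℝ) / n)} =
      (↑((Finset.range (n * n)).image (fun k : ℕ => (k : ℝ) / n)))ᶜ := by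
    ext a
    simp only [mem_setOf_eq, mem_compl_iff, Finset.mem_coe]
  rw [hset]
  exact h

end Discretised

end Literature.Analysis.InverseSpectral

end
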